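import Literature.MathematicalPhysics.QuantumLattice.KaplanHorschVonDerLindenU1System
import Literature.MathematicalPhysics.QuantumLattice.KomaTasakiSSBOverlap
import HarnessLib

/-!
# Kaplan–Horsch–von der Linden (KT93 Theorem 7.1, (7.9)–(7.10)) for Koma–Tasaki `U(1)` systems with
# BOUNDED-OVERLAP order densities (bond pair fields of lattice electrons, KT94 §3.4)

T. Koma, H. Tasaki, Commun. Math. Phys. **158** (1993) 191–214 (`KomaTasaki1993`), §7 (7.9):

> `(Ψ'_Λ, H_ΛΨ'_Λ) = (Φ_Λ, O_Λ[H_Λ, O_Λ]Φ_Λ)/(Φ_Λ,(O_Λ)²Φ_Λ) + E_Λ = (Φ_Λ,[O_Λ,[H_Λ,O_Λ]]Φ_Λ)/(2(Φ_Λ,(O_Λ)²Φ_Λ)) + E_Λ ≤ O(N)/(σ_Λ²N²) + E_Λ`,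
> "where we have used the assumptions i), ii), and (7.8)",

and J. Stat. Phys. **76** (1994) 745–803 (`KomaTasaki1994`), §3.4: for superconducting order parameters built
from bond pair fields the densities `o_x`, `o_y` on overlapping bonds do not commute and the argument goes through
"with some extra care".  The tree's Horsch–von der Linden bound (`KomaTasaki.horschVonDerLinden_holds`, constant
`c₀ = 2r²h̄μ⁻²`) and its Kaplan–Horsch–von der Linden consequences (`KaplanHorschVonDerLindenFieldBound.lean`,
`KaplanHorschVonDerLindenU1System.lean`) assume hypothesis i) `[o_x, o_y] = 0` for ALL `x, y`.  This file supplies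
the "extra care": for a `KomaTasaki.U1OverlapSystem` (i′) `[o_x, o_y] = 0` unless `y ∈ T_x`, `|T_x| ≤ r′`;
ii) `[h_x, o_y] = 0` unless `y ∈ S_x`, `|S_x| ≤ r`) the double commutator localises as
`[[O,H],O] = Σ_x Σ_{y∈S_x} Σ_{z∈S_x∪T_y} [[o_y,h_x],o_z]`, so `‖[[O,H],O]‖ ≤ 4r(r+r′)h̄ō²N` and

* `U1OverlapSystem.horschVonDerLinden` — `|⟨Ψ',HΨ'⟩ - E| ≤ 2r(r+r′)h̄/(μ²N)`, `Ψ' = O^{(1)}Φ/‖O^{(1)}Φ‖`, for a unit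
  eigenvector `Φ` of `H` with `(μōN)² ≤ Re⟨Φ,(O^{(1)})²Φ⟩`, `μ > 0` (KT94 Theorem 2.2 with overlap);
* `U1OverlapSystem.kaplanHorschVonDerLinden_order_density` — for such `Φ` which is moreover a `C`-eigenvector and a
  ground state, every `B > 0` and EVERY ground state `Φ_B` of `H - B·O^{(1)}`:
  **`N⁻¹ Re⟨Φ_B, O^{(1)}Φ_B⟩ ≥ μō - r(r+r′)h̄/(μ²BN²)`** (KT93 (7.10); the odd moments vanish by the `U(1)` charge,
  `U1System.inner_order_zero(_cube)_eq_zero_of_eigen_C` applied to the one-site collapse); `…_of_isLROEigenstate`.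

The instance this is written for is the Hubbard model with a bond pair field (`dWaveKTSystem`, `DWaveKomaTasakiSystem.lean`,
`r = r′ = 25`): see `HubbardDWaveGroundStateFiniteVolumeFieldBound.lean`.  No definitions, no named facts, no sorry.

## References
* [KomaTasaki1993] T. Koma, H. Tasaki, Commun. Math. Phys. **158** (1993) 191–214, Theorem 7.1, (7.4)–(7.10), i'); p. 211.
* [KomaTasaki1994] T. Koma, H. Tasaki, J. Stat. Phys. **76** (1994) 745–803, Theorem 2.2 (2.9), §2.3, §3.4.
* [KaplanHorschVonDerLinden1989] T. A. Kaplan, P. Horsch, W. von der Linden, J. Phys. Soc. Jpn. **58** (1989) 3894.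
-/

noncomputable section

open Complex Finset Filter
open scoped InnerProductSpace ComplexConjugate Topology

namespace Literature.MathematicalPhysics.QuantumLattice.KomaTasaki

universe u v

variable {Λ : Type u} [Fintype Λ] [Nonempty Λ] {E : Type v} [NormedAddCommGroup E] [InnerProductSpace ℂ E]

namespace U1OverlapSystem

variable (sys : U1OverlapSystem Λ E)

omit [Nonempty Λ] in
/-- `O^{(α)}` is symmetric. [cite: KomaTasaki1994, §2.3] -/
theorem inner_order_left (α : Fin 2) (φ ψ : E) : ⟪sys.order α φ, ψ⟫_ℂ = ⟪φ, sys.order α ψ⟫_ℂ := by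
  simp only [order, FunLike.coe_sum, Finset.sum_apply, sum_inner, inner_sum]
  exact Finset.sum_congr rfl fun x _ => sys.isSymmetric_o α x φ ψ

omit [Nonempty Λ] in
/-- `H` is symmetric. [cite: KomaTasaki1994, §2.1] -/
theorem inner_hamiltonian_left (φ ψ : E) : ⟪sys.hamiltonian φ, ψ⟫_ℂ = ⟪φ, sys.hamiltonian ψ⟫_ℂ := by
  simp only [hamiltonian, FunLike.coe_sum, Finset.sum_apply, sum_inner, inner_sum]
  exact Finset.sum_congr rfl fun x _ => sys.isSymmetric_h x φ ψ

/-- **Horsch–von der Linden with bounded overlap (KT94 Theorem 2.2 under i′); KT93 (7.9)).**  For a unit eigenvector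
`Φ` of `H_Λ` (eigenvalue `E`) with `(μōN)² ≤ Re⟨Φ,(O^{(1)})²Φ⟩`, `μ > 0`: `O^{(1)}Φ ≠ 0` and the normalised state
`Ψ' = O^{(1)}Φ/‖O^{(1)}Φ‖` has `|Re⟨Ψ', H_ΛΨ'⟩ - E| ≤ 2r(r+r′)h̄/(μ²N)`.  Proof as in KT: the double-commutator
identity `⟨Φ,[[O,H],O]Φ⟩ = 2(⟨OΦ,HOΦ⟩ - E‖OΦ‖²)`, the localisation
`[[O,H],O] = Σ_x Σ_{y∈S_x} Σ_{z∈S_x∪T_y} [[o_y,h_x],o_z]` (ii) and i′): `o_z` commutes with `h_x` for `z ∉ S_x` and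
with `o_y` for `z ∉ T_y`), and `‖[[o_y,h_x],o_z]‖ ≤ 4h̄ō²`.
[cite: KomaTasaki1994, Theorem 2.2 (2.9), §3.4] [cite: KomaTasaki1993, §7 (7.9)] -/
theorem horschVonDerLinden [FiniteDimensional ℂ E] {Φ : E} {EΛ μ : ℝ} (hΦ1 : ‖Φ‖ = 1)
    (hHΦ : sys.hamiltonian Φ = (EΛ : ℂ) • Φ) (hμ : 0 < μ)
    (hlro : (μ * sys.obar * Fintype.card Λ) ^ 2 ≤ (⟪Φ, sys.order 0 (sys.order 0 Φ)⟫_ℂ).re) :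
    sys.order 0 Φ ≠ 0 ∧
      |(⟪(‖sys.order 0 Φ‖⁻¹ : ℂ) • sys.order 0 Φ,
          sys.hamiltonian ((‖sys.order 0 Φ‖⁻¹ : ℂ) • sys.order 0 Φ)⟫_ℂ).re - EΛ| ≤
        (2 * sys.r * (sys.r + sys.r') * sys.hbar / μ ^ 2) / Fintype.card Λ := by
  classical
  set O : E →L[ℂ] E := sys.order 0 with hOdef
  set H : E →L[ℂ] E := sys.hamiltonian with hHdef
  have hN : (0 : ℝ) < Fintype.card Λ := Nat.cast_pos.mpr Fintype.card_pos
  have hhbar : 0 ≤ sys.hbar := (norm_nonneg _).trans (sys.norm_h_le (Classical.arbitrary Λ))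
  have hOsym : ∀ φ ψ : E, ⟪O φ, ψ⟫_ℂ = ⟪φ, O ψ⟫_ℂ := sys.inner_order_left 0
  have hHsym : ∀ φ ψ : E, ⟪H φ, ψ⟫_ℂ = ⟪φ, H ψ⟫_ℂ := sys.inner_hamiltonian_left
  -- Step 1: `‖OΦ‖² = ⟨Φ, O²Φ⟩ ≥ (μ o N)² > 0`
  have hb : (⟪O Φ, O Φ⟫_ℂ).re = ‖O Φ‖ ^ 2 := by
    rw [← inner_self_eq_norm_sq (𝕜 := ℂ) (O Φ), RCLike.re_to_complex]
  have hnormsq : (⟪Φ, O (O Φ)⟫_ℂ).re = ‖O Φ‖ ^ 2 := by rw [← hOsym, hb]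
  have hnorm2_ge : (μ * sys.obar * Fintype.card Λ) ^ 2 ≤ ‖O Φ‖ ^ 2 := hnormsq ▸ hlro
  have hpos : 0 < (μ * sys.obar * Fintype.card Λ) ^ 2 := by
    have := sys.obar_pos
    positivity
  have hOΦ_ne : O Φ ≠ 0 := by
    intro h0
    rw [h0, norm_zero] at hnorm2_ge
    linarith
  have hn2 : (0 : ℝ) < ‖O Φ‖ ^ 2 := by
    have := norm_pos_iff.mpr hOΦ_ne
    positivity
  refine ⟨hOΦ_ne, ?_⟩
  -- Step 2: the double commutator and the energy identity
  set D : E →L[ℂ] E := (O * H - H * O) * O - O * (O * H - H * O) with hDdef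
  have hD_inner : ⟪Φ, D Φ⟫_ℂ = 2 * (⟪O Φ, H (O Φ)⟫_ℂ - (EΛ : ℂ) * ⟪O Φ, O Φ⟫_ℂ) := by
    have h1 : ⟪Φ, O (H (O Φ))⟫_ℂ = ⟪O Φ, H (O Φ)⟫_ℂ := (hOsym Φ _).symm
    have h2 : ⟪Φ, H (O (O Φ))⟫_ℂ = (EΛ : ℂ) * ⟪O Φ, O Φ⟫_ℂ := by
      rw [← hHsym, hHΦ, inner_smul_left, Complex.conj_ofReal, ← hOsym]
    have h3 : ⟪Φ, O (O (H Φ))⟫_ℂ = (EΛ : ℂ) * ⟪O Φ, O Φ⟫_ℂ := by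
      rw [hHΦ, map_smul, map_smul, inner_smul_right, ← hOsym]
    simp only [hDdef, sub_apply, mul_apply_eq_comp, map_sub,
      inner_sub_right, h1, h2, h3]
    ring
  -- Step 3: locality of the double commutator, with overlap
  have hO_sum : O = ∑ x, sys.o 0 x := rfl
  have hH_sum : H = ∑ x, sys.h x := rfl
  have hcommOH : O * H - H * O = ∑ x, ∑ y ∈ sys.supp x, (sys.o 0 y * sys.h x - sys.h x * sys.o 0 y) := by
    have e1 : O * H - H * O = ∑ x, (O * sys.h x - sys.h x * O) := by
      simp only [hH_sum, Finset.mul_sum, Finset.sum_mul, Finset.sum_sub_distrib]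
    rw [e1]
    refine Finset.sum_congr rfl fun x _ => ?_
    have e2 : O * sys.h x - sys.h x * O = ∑ y, (sys.o 0 y * sys.h x - sys.h x * sys.o 0 y) := by
      simp only [hO_sum, Finset.sum_mul, Finset.mul_sum, Finset.sum_sub_distrib]
    rw [e2]
    exact (Finset.sum_subset (Finset.subset_univ _)
      (fun y _ hy => sub_eq_zero.mpr (sys.commute_h_o x y hy 0).eq.symm)).symm
  have hD_local : D = ∑ x, ∑ y ∈ sys.supp x, ∑ z ∈ sys.supp x ∪ sys.osupp y,
      ((sys.o 0 y * sys.h x - sys.h x * sys.o 0 y) * sys.o 0 z -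
        sys.o 0 z * (sys.o 0 y * sys.h x - sys.h x * sys.o 0 y)) := by
    rw [hDdef, hcommOH]
    simp only [Finset.sum_mul, Finset.mul_sum, ← Finset.sum_sub_distrib]
    refine Finset.sum_congr rfl fun x _ => Finset.sum_congr rfl fun y _ => ?_
    rw [hO_sum]
    simp only [Finset.sum_mul, Finset.mul_sum, ← Finset.sum_sub_distrib]
    refine (Finset.sum_subset (Finset.subset_univ _) (fun z _ hz => ?_)).symm
    rw [Finset.mem_union, not_or] at hz
    exact comm_comm_eq_zero (sys.commute_o y z hz.2 0 0) (sys.commute_h_o x z hz.1 0)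
  -- Step 4: the norm bound `‖D‖ ≤ 4 r (r + r') h o² N`
  have hterm : ∀ x y z, ‖(sys.o 0 y * sys.h x - sys.h x * sys.o 0 y) * sys.o 0 z -
      sys.o 0 z * (sys.o 0 y * sys.h x - sys.h x * sys.o 0 y)‖ ≤ 4 * sys.hbar * sys.obar ^ 2 := by
    intro x y z
    calc ‖(sys.o 0 y * sys.h x - sys.h x * sys.o 0 y) * sys.o 0 z -
          sys.o 0 z * (sys.o 0 y * sys.h x - sys.h x * sys.o 0 y)‖
        ≤ 4 * ‖sys.o 0 y‖ * ‖sys.h x‖ * ‖sys.o 0 z‖ := norm_comm_comm_le _ _ _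
      _ ≤ 4 * sys.obar * sys.hbar * sys.obar := by
          have := sys.norm_o_le 0 y; have := sys.norm_o_le 0 z; have := sys.norm_h_le x
          have := sys.obar_pos
          gcongr
      _ = 4 * sys.hbar * sys.obar ^ 2 := by ring
  have hcardU : ∀ x y, ((sys.supp x ∪ sys.osupp y).card : ℝ) ≤ sys.r + sys.r' := by
    intro x y
    have h1 := Finset.card_union_le (sys.supp x) (sys.osupp y)
    have h2 := sys.card_supp_le x
    have h3 := sys.card_osupp_le y
    exact_mod_cast h1.trans (add_le_add h2 h3)
  have hD_norm : ‖D‖ ≤ 4 * sys.r * (sys.r + sys.r') * sys.hbar * sys.obar ^ 2 * Fintype.card Λ := by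
    rw [hD_local]
    calc ‖∑ x, ∑ y ∈ sys.supp x, ∑ z ∈ sys.supp x ∪ sys.osupp y,
            ((sys.o 0 y * sys.h x - sys.h x * sys.o 0 y) * sys.o 0 z -
              sys.o 0 z * (sys.o 0 y * sys.h x - sys.h x * sys.o 0 y))‖
        ≤ ∑ x, ∑ y ∈ sys.supp x, ∑ z ∈ sys.supp x ∪ sys.osupp y, (4 * sys.hbar * sys.obar ^ 2) := by
          refine (norm_sum_le _ _).trans (Finset.sum_le_sum fun x _ => ?_)
          refine (norm_sum_le _ _).trans (Finset.sum_le_sum fun y _ => ?_)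
          exact (norm_sum_le _ _).trans (Finset.sum_le_sum fun z _ => hterm x y z)
      _ = ∑ x, ∑ y ∈ sys.supp x, ((sys.supp x ∪ sys.osupp y).card : ℝ) * (4 * sys.hbar * sys.obar ^ 2) := by
          simp only [Finset.sum_const, nsmul_eq_mul]
      _ ≤ ∑ x, ∑ _y ∈ sys.supp x, ((sys.r : ℝ) + sys.r') * (4 * sys.hbar * sys.obar ^ 2) := by
          refine Finset.sum_le_sum fun x _ => Finset.sum_le_sum fun y _ => ?_
          have := hcardU x y
          have h4 : 0 ≤ 4 * sys.hbar * sys.obar ^ 2 := by positivity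
          exact mul_le_mul_of_nonneg_right this h4
      _ = ∑ x, ((sys.supp x).card : ℝ) * (((sys.r : ℝ) + sys.r') * (4 * sys.hbar * sys.obar ^ 2)) := by
          simp only [Finset.sum_const, nsmul_eq_mul]
      _ ≤ ∑ _x : Λ, (sys.r : ℝ) * (((sys.r : ℝ) + sys.r') * (4 * sys.hbar * sys.obar ^ 2)) := by
          refine Finset.sum_le_sum fun x _ => ?_
          have hx : ((sys.supp x).card : ℝ) ≤ sys.r := by exact_mod_cast sys.card_supp_le x
          have h4 : 0 ≤ ((sys.r : ℝ) + sys.r') * (4 * sys.hbar * sys.obar ^ 2) := by positivity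
          exact mul_le_mul_of_nonneg_right hx h4
      _ = 4 * sys.r * (sys.r + sys.r') * sys.hbar * sys.obar ^ 2 * Fintype.card Λ := by
          simp only [Finset.sum_const, Finset.card_univ, nsmul_eq_mul]
          ring
  -- Step 5: `|⟨Φ, DΦ⟩| ≤ ‖D‖`
  have hinner_le : |(⟪Φ, D Φ⟫_ℂ).re| ≤ ‖D‖ :=
    calc |(⟪Φ, D Φ⟫_ℂ).re| ≤ ‖⟪Φ, D Φ⟫_ℂ‖ := Complex.abs_re_le_norm _
      _ ≤ ‖Φ‖ * ‖D Φ‖ := norm_inner_le_norm _ _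
      _ ≤ ‖Φ‖ * (‖D‖ * ‖Φ‖) := by gcongr; exact D.le_opNorm Φ
      _ = ‖D‖ := by rw [hΦ1]; ring
  -- Step 6: assemble
  have hAB : (⟪O Φ, H (O Φ)⟫_ℂ).re - EΛ * ‖O Φ‖ ^ 2 = (⟪Φ, D Φ⟫_ℂ).re / 2 := by
    have h2 := congrArg Complex.re hD_inner
    simp only [Complex.mul_re, Complex.sub_re, Complex.sub_im, Complex.ofReal_re,
      Complex.ofReal_im, Complex.re_ofNat, Complex.im_ofNat, zero_mul, sub_zero] at h2
    rw [hb] at h2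
    linarith
  rw [re_inner_normalize_apply]
  have hkey : (⟪O Φ, H (O Φ)⟫_ℂ).re / ‖O Φ‖ ^ 2 - EΛ =
      (⟪Φ, D Φ⟫_ℂ).re / (2 * ‖O Φ‖ ^ 2) := by
    rw [eq_div_iff (by positivity)]
    calc ((⟪O Φ, H (O Φ)⟫_ℂ).re / ‖O Φ‖ ^ 2 - EΛ) * (2 * ‖O Φ‖ ^ 2)
        = 2 * ((⟪O Φ, H (O Φ)⟫_ℂ).re / ‖O Φ‖ ^ 2 * ‖O Φ‖ ^ 2) - 2 * (EΛ * ‖O Φ‖ ^ 2) := by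
          ring
      _ = 2 * ((⟪O Φ, H (O Φ)⟫_ℂ).re - EΛ * ‖O Φ‖ ^ 2) := by
          rw [div_mul_cancel₀ _ hn2.ne']; ring
      _ = (⟪Φ, D Φ⟫_ℂ).re := by rw [hAB]; ring
  rw [hkey, abs_div, abs_of_pos (by positivity : (0 : ℝ) < 2 * ‖O Φ‖ ^ 2)]
  have hμo : 0 < μ * sys.obar * Fintype.card Λ := by
    have := sys.obar_pos
    positivity
  calc |(⟪Φ, D Φ⟫_ℂ).re| / (2 * ‖O Φ‖ ^ 2)
      ≤ (4 * sys.r * (sys.r + sys.r') * sys.hbar * sys.obar ^ 2 * Fintype.card Λ) /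
          (2 * (μ * sys.obar * Fintype.card Λ) ^ 2) := by
        gcongr
        exact hinner_le.trans hD_norm
    _ = 2 * sys.r * (sys.r + sys.r') * sys.hbar / μ ^ 2 / Fintype.card Λ := by
        have := sys.obar_pos
        field_simp
        ring

/-- **KAPLAN–HORSCH–VON DER LINDEN WITH BOUNDED OVERLAP (KT93 (7.10) under i′), finite volume, explicit constant,
no size condition).**  Let `sys` be a `U1OverlapSystem` on a nonempty lattice (`N` sites), `Φ` a unit vector with
`H_ΛΦ = E_ΛΦ`, `C_ΛΦ = cΦ`, `(μōN)² ≤ Re⟨Φ,(O^{(1)}_Λ)²Φ⟩`, `μ > 0`, `E_Λ` the ground-state energy.  Then for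
every `B > 0` and EVERY unit `Φ_B` minimising `Re⟨ψ,(H_Λ - B·O^{(1)}_Λ)ψ⟩`:
**`N⁻¹ Re⟨Φ_B, O^{(1)}_ΛΦ_B⟩ ≥ μō - r(r+r′)h̄/(μ²BN²)`**.  The odd moments `⟨Φ,O^{(1)}Φ⟩`, `⟨Φ,(O^{(1)})³Φ⟩` vanish by
the `U(1)` charge (KT93 i'); `U1System.inner_order_zero(_cube)_eq_zero_of_eigen_C` on the one-site collapse); then
KT93 (7.4)–(7.5) (`khvdl_order_ge`) with the overlap Horsch–von der Linden bound.
[cite: KomaTasaki1993, Theorem 7.1 (7.10), i'); p. 211] [cite: KomaTasaki1994, Theorem 2.2, §3.4] [cite: KaplanHorschVonDerLinden1989, main theorem] -/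
theorem kaplanHorschVonDerLinden_order_density [FiniteDimensional ℂ E] {Φ : E} {EΛ μ : ℝ} {c : ℂ}
    (hΦ1 : ‖Φ‖ = 1) (hHΦ : sys.hamiltonian Φ = (EΛ : ℂ) • Φ) (hC : sys.C Φ = c • Φ) (hμ : 0 < μ)
    (hlro : (μ * sys.obar * Fintype.card Λ) ^ 2 ≤ (⟪Φ, sys.order 0 (sys.order 0 Φ)⟫_ℂ).re)
    (hground : ∀ ψ : E, ‖ψ‖ = 1 → EΛ ≤ (⟪ψ, sys.hamiltonian ψ⟫_ℂ).re)
    {B : ℝ} (hB : 0 < B) {ΦB : E} (hΦB : ‖ΦB‖ = 1)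
    (hmin : ∀ ψ : E, ‖ψ‖ = 1 →
      (⟪ΦB, (sys.hamiltonian - (B : ℂ) • sys.order 0) ΦB⟫_ℂ).re ≤
        (⟪ψ, (sys.hamiltonian - (B : ℂ) • sys.order 0) ψ⟫_ℂ).re) :
    μ * sys.obar - sys.r * (sys.r + sys.r') * sys.hbar / μ ^ 2 / (B * (Fintype.card Λ : ℝ) ^ 2) ≤
      (⟪ΦB, sys.order 0 ΦB⟫_ℂ).re / Fintype.card Λ := by
  obtain ⟨hne, hbound⟩ := sys.horschVonDerLinden hΦ1 hHΦ hμ hlro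
  have hOsym : ∀ φ ψ : E, ⟪sys.order 0 φ, ψ⟫_ℂ = ⟪φ, sys.order 0 ψ⟫_ℂ := sys.inner_order_left 0
  have hHsym : ∀ φ ψ : E, ⟪sys.hamiltonian φ, ψ⟫_ℂ = ⟪φ, sys.hamiltonian ψ⟫_ℂ := sys.inner_hamiltonian_left
  -- the odd moments vanish (charge bookkeeping on the one-site collapse)
  have hC' : sys.collapse.C Φ = c • Φ := by rw [collapse_C]; exact hC
  have hOΦ : ⟪Φ, sys.order 0 Φ⟫_ℂ = 0 := by
    have h := sys.collapse.inner_order_zero_eq_zero_of_eigen_C hC'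
    rwa [collapse_order] at h
  have hO3 : ⟪Φ, sys.order 0 (sys.order 0 (sys.order 0 Φ))⟫_ℂ = 0 := by
    have h := sys.collapse.inner_order_zero_cube_eq_zero_of_eigen_C hC'
    rwa [collapse_order] at h
  -- (7.4)–(7.5)
  have hk := khvdl_order_ge hHsym hOsym hΦ1 hHΦ hground hOΦ hO3 hne hB hΦB hmin
  have hfloor : μ * sys.obar * Fintype.card Λ ≤ ‖sys.order 0 Φ‖ :=
    norm_order_apply_ge hμ.le sys.obar_pos.le hOsym hlro
  have hδ : ((⟪hvdlState (sys.order 0) Φ, sys.hamiltonian (hvdlState (sys.order 0) Φ)⟫_ℂ).re - EΛ) / (2 * B) ≤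
      (2 * sys.r * (sys.r + sys.r') * sys.hbar / μ ^ 2) / Fintype.card Λ / (2 * B) := by
    apply div_le_div_of_nonneg_right _ (by positivity)
    have := (abs_le.mp hbound).2
    rw [hvdlState_def]
    linarith
  have hN : (0 : ℝ) < Fintype.card Λ := Nat.cast_pos.mpr Fintype.card_pos
  rw [le_div_iff₀ hN]
  have halg : (μ * sys.obar - sys.r * (sys.r + sys.r') * sys.hbar / μ ^ 2 / (B * (Fintype.card Λ : ℝ) ^ 2)) *
      Fintype.card Λ =
      μ * sys.obar * Fintype.card Λ -
        (2 * sys.r * (sys.r + sys.r') * sys.hbar / μ ^ 2) / Fintype.card Λ / (2 * B) := by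
    field_simp
  rw [halg]
  linarith

/-- **The same for a ground state with obscured symmetry breaking iv)** (`sys.IsLROEigenstate Φ E_Λ μ`):
`N⁻¹ Re⟨Φ_B, O^{(1)}_ΛΦ_B⟩ ≥ μō - r(r+r′)h̄/(μ²BN²)` for every ground state `Φ_B` of `H_Λ - B·O^{(1)}_Λ`, `B > 0`.
[cite: KomaTasaki1993, Theorem 7.1 (7.10)] [cite: KomaTasaki1994, §2.3 iv), Theorem 2.2, §3.4] -/
theorem kaplanHorschVonDerLinden_order_density_of_isLROEigenstate [FiniteDimensional ℂ E] {Φ : E} {EΛ μ : ℝ}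
    (hΦ : sys.IsLROEigenstate Φ EΛ μ)
    (hground : ∀ ψ : E, ‖ψ‖ = 1 → EΛ ≤ (⟪ψ, sys.hamiltonian ψ⟫_ℂ).re)
    {B : ℝ} (hB : 0 < B) {ΦB : E} (hΦB : ‖ΦB‖ = 1)
    (hmin : ∀ ψ : E, ‖ψ‖ = 1 →
      (⟪ΦB, (sys.hamiltonian - (B : ℂ) • sys.order 0) ΦB⟫_ℂ).re ≤
        (⟪ψ, (sys.hamiltonian - (B : ℂ) • sys.order 0) ψ⟫_ℂ).re) :
    μ * sys.obar - sys.r * (sys.r + sys.r') * sys.hbar / μ ^ 2 / (B * (Fintype.card Λ : ℝ) ^ 2) ≤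
      (⟪ΦB, sys.order 0 ΦB⟫_ℂ).re / Fintype.card Λ := by
  obtain ⟨c, hC⟩ := hΦ.eigen_C
  have hH : sys.hamiltonian Φ = (EΛ : ℂ) • Φ := by
    have h := hΦ.eigen_hamiltonian
    rwa [collapse_hamiltonian] at h
  have hlro : (μ * sys.obar * Fintype.card Λ) ^ 2 ≤ (⟪Φ, sys.order 0 (sys.order 0 Φ)⟫_ℂ).re := by
    have h := hΦ.lro
    rwa [collapse_order, collapse_obar, Fintype.card_unit, Nat.cast_one, mul_one, ← mul_assoc] at h
  exact sys.kaplanHorschVonDerLinden_order_density hΦ.norm_eq_one hH (by rw [← collapse_C]; exact hC) hΦ.mu_pos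
    hlro hground hB hΦB hmin

end U1OverlapSystem

end Literature.MathematicalPhysics.QuantumLattice.KomaTasaki
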